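import Literature.AnabelianGeometry.SemiGraphs.PSCUnrShadowPackages
import Literature.AnabelianGeometry.SemiGraphs.PSCCoveringBranchDataProofs
import Literature.AnabelianGeometry.SemiGraphs.PSCThm16iiiAssemblyPrimeProofs
import HarnessLib

/-!
# [CombGC] Theorem 1.6 (iii) for general `Σ` ("we may assume `Σ = {l}`"): the descent from the pro-l shadows

Mochizuki, *A combinatorial version of the Grothendieck conjecture*, Tohoku Math. J. **59** (2007)
[CombGC], Thm. 1.6 (iii), author's ms p. 13, with the reduction p. 13 l.−8…−4 ("… we may assume that
`Σ = {l}`") and the proof p. 14; [IUTchI] Rmk. 1.2.3 (vii).  Row T16-L04c «(iii) general Σ» of the abc-iut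
sub-DAG `plan/L3/SUBDAG-CombGC-Thm16.md` (lineage abc-iut-w4-d052).  The cell's kernel proof of (iii)
(abc-iut-w5-d174's `unrVerticialIff_holds_of_inputs'`) is typed at `Σ = {l}` (its printed inputs carry
`Σ = {l}` inside); for a common prime `l` we descend from the pro-`l` SHADOWS of the `Π^unr`-coverings:
`β` v.f.p. ⇒ `ρ` v.f.p. (`PSCUnrShadowTransfer`) ⇒ [(iii) at `Σ = {l}`] `ρ` group-theoretically verticial ⇒
[`PSCUnrShadowPackages`] level vertex classes correspond modulo `L = ker(U ↠ Q_l ↠ Q_l/Ker)↑`, separated by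
Prop. 1.2 (i) ⇒ [this file] vertex STABILIZERS correspond under `β` at every level ⇒ [abc-iut-L5-t6's
`isUnrVerticial_iff_levelwise`] `β` group-theoretically verticial.  CLOSER
`unrVerticialIff_holds_of_common_prime'`: **[CombGC] Thm. 1.6 (iii) as typed, for all `Ω`-data on profinite
groups with a COMMON PRIME and every `β`**, from the named origin statements of the `Σ = {l}` assembly +
`MapAlongProLOfPSCTypeHolds` (abc-iut-L3-t4) + `OpenInterDeterminesComponentHolds`; (⇐) is [IUTchI]
Rmk. 1.2.3 (vii) (abc-iut-L5).  Proof-only, 0 defs; no new origin statement; nothing here takes a side on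
[IUTchIII] Cor. 3.12. [cite: MochizukiCombGC2007, Thm 1.6(iii) p.13] [cite: Mochizuki2012, IUTchI Rmk 1.2.3(vii) p.43]
-/

namespace Literature.AnabelianGeometry.SemiGraphs

open scoped Pointwise
open PSCCovering

universe u

namespace PSCDatum

/-! ### 1. Transport and conjugation; vertex stabilizers at a level -/

section Stabilizers

variable {P : Type u} [Group P] [TopologicalSpace P] [IsTopologicalGroup P]
variable {P' : Type u} [Group P'] [TopologicalSpace P'] [IsTopologicalGroup P']
variable (G : PSCDatum P) (H : PSCDatum P') (β : (P ⧸ G.unrKer) ≃ₜ* (P' ⧸ H.unrKer))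

/-- **The transport commutes with conjugation**: `β(p X p⁻¹) = p' β(X) p'⁻¹` whenever `β [p] = [p']`.
[cite: MochizukiCombGC2007, Def 1.4(iii) p.10] -/
theorem unrTransport_conjAct_smul {p : P} {p' : P'}
    (hp : β (QuotientGroup.mk p) = (QuotientGroup.mk p' : P' ⧸ H.unrKer)) (X : Subgroup P) :
    G.unrTransport H β (ConjAct.toConjAct p • X) = ConjAct.toConjAct p' • G.unrTransport H β X := by
  ext y
  rw [G.mem_unrTransport_iff H β, Subgroup.mem_smul_pointwise_iff_exists]
  constructor
  · rintro ⟨s, hs, hsy⟩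
    obtain ⟨t, ht, rfl⟩ := (Subgroup.mem_smul_pointwise_iff_exists _ _ _).mp hs
    refine ⟨p'⁻¹ * y * p', (G.mem_unrTransport_iff H β).mpr ⟨t, ht, ?_⟩, ?_⟩
    · simp only [ConjAct.smul_def, ConjAct.ofConjAct_toConjAct, QuotientGroup.mk_mul,
        QuotientGroup.mk_inv, map_mul, map_inv, hp] at hsy
      rw [QuotientGroup.mk_mul, QuotientGroup.mk_mul, QuotientGroup.mk_inv, ← hsy]
      group
    · simp only [ConjAct.smul_def, ConjAct.ofConjAct_toConjAct]
      group
  · rintro ⟨z, hz, rfl⟩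
    obtain ⟨t, ht, htz⟩ := (G.mem_unrTransport_iff H β).mp hz
    refine ⟨p * t * p⁻¹, (Subgroup.mem_smul_pointwise_iff_exists _ _ _).mpr ⟨t, ht, by
      simp only [ConjAct.smul_def, ConjAct.ofConjAct_toConjAct]⟩, ?_⟩
    simp only [ConjAct.smul_def, ConjAct.ofConjAct_toConjAct, QuotientGroup.mk_mul, QuotientGroup.mk_inv,
      map_mul, map_inv, hp, htz]

variable {G}

omit [IsTopologicalGroup P] [TopologicalSpace P'] [IsTopologicalGroup P'] in
/-- Elements of `U · Π_v^x` act on `X = (U ∩ Π_v^x) · L` as elements of `U` do. [cite: MochizukiCombGC2007, Def 1.1(ii) p.6] -/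
theorem exists_conj_eq_of_mem_vertexStabilizer {U L : Subgroup P} [U.Normal] [L.Normal]
    {v : G.graph.V} {x p : P} (hp : p ∈ U ⊔ ConjAct.toConjAct x • G.vertGp v) :
    ∃ u ∈ U, ConjAct.toConjAct p • ((U ⊓ ConjAct.toConjAct x • G.vertGp v) ⊔ L) =
      ConjAct.toConjAct u • ((U ⊓ ConjAct.toConjAct x • G.vertGp v) ⊔ L) := by
  have hp' : p ∈ ((U ⊔ ConjAct.toConjAct x • G.vertGp v : Subgroup P) : Set P) := hp
  rw [Subgroup.normal_mul] at hp'
  obtain ⟨u, hu, k, hk, rfl⟩ := Set.mem_mul.mp hp'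
  refine ⟨u, hu, ?_⟩
  rw [map_mul, mul_smul]
  congr 1
  rw [Subgroup.smul_sup, Subgroup.smul_inf, Subgroup.Normal.conjAct (inferInstance : U.Normal),
    Subgroup.conjAct_pointwise_smul_eq_self (Subgroup.le_normalizer hk),
    Subgroup.Normal.conjAct (inferInstance : L.Normal)]

omit [IsTopologicalGroup P] [TopologicalSpace P'] [IsTopologicalGroup P'] in
/-- Conversely, granted SEPARATION modulo `L` of the level-`U` vertex classes: if `p X p⁻¹` is a
`U`-conjugate of `X = (U ∩ Π_v^x) · L`, then `p ∈ U · Π_v^x`. [cite: MochizukiCombGC2007, Thm 1.6(iii) p.13] -/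
theorem mem_vertexStabilizer_of_conj_eq {U L : Subgroup P} [U.Normal] [L.Normal]
    (hsep : ∀ (v₁ v₂ : G.graph.V) (x₁ x₂ : P),
      (∃ u ∈ U, (U ⊓ ConjAct.toConjAct x₁ • G.vertGp v₁) ⊔ L =
        ConjAct.toConjAct u • ((U ⊓ ConjAct.toConjAct x₂ • G.vertGp v₂) ⊔ L)) →
      (⟨v₁, DoubleCoset.mk U (G.vertGp v₁) x₁⟩ :
          Σ v, DoubleCoset.Quotient (U : Set P) (G.vertGp v : Set P)) =
        ⟨v₂, DoubleCoset.mk U (G.vertGp v₂) x₂⟩)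
    {v : G.graph.V} {x p u : P} (hu : u ∈ U)
    (h : ConjAct.toConjAct p • ((U ⊓ ConjAct.toConjAct x • G.vertGp v) ⊔ L) =
      ConjAct.toConjAct u • ((U ⊓ ConjAct.toConjAct x • G.vertGp v) ⊔ L)) :
    p ∈ U ⊔ ConjAct.toConjAct x • G.vertGp v := by
  -- `u⁻¹ p` fixes `X`, i.e. the class of `u⁻¹ p x` is that of `x`
  have h2 : ConjAct.toConjAct (u⁻¹ * p) • ((U ⊓ ConjAct.toConjAct x • G.vertGp v) ⊔ L) =
      (U ⊓ ConjAct.toConjAct x • G.vertGp v) ⊔ L := by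
    rw [map_mul, mul_smul, h, ← mul_smul, ← map_mul, inv_mul_cancel, map_one, one_smul]
  have h1 : (U ⊓ ConjAct.toConjAct (u⁻¹ * p * x) • G.vertGp v) ⊔ L =
      ConjAct.toConjAct (1 : P) • ((U ⊓ ConjAct.toConjAct x • G.vertGp v) ⊔ L) := by
    rw [map_one, one_smul]
    conv_rhs => rw [← h2, Subgroup.smul_sup, Subgroup.smul_inf,
      Subgroup.Normal.conjAct (inferInstance : U.Normal), Subgroup.Normal.conjAct (inferInstance : L.Normal),
      ← mul_smul, ← map_mul]
  have h3 := hsep v v (u⁻¹ * p * x) x ⟨1, U.one_mem, h1⟩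
  obtain ⟨-, hidx⟩ := Sigma.mk.inj_iff.mp h3
  have hmk : DoubleCoset.mk U (G.vertGp v) (u⁻¹ * p * x) = DoubleCoset.mk U (G.vertGp v) x := eq_of_heq hidx
  obtain ⟨u₁, hu₁, k, hk, hx⟩ := (DoubleCoset.eq _ _ _ _).mp hmk
  -- `x = u₁ (u⁻¹ p x) k`, so `p = u u₁⁻¹ · x k⁻¹ x⁻¹`
  have hp : p = (u * u₁⁻¹) * (x * k⁻¹ * x⁻¹) := by
    have : u₁⁻¹ * x * k⁻¹ = u⁻¹ * p * x := by
      conv_lhs => rw [hx]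
      group
    calc p = u * (u⁻¹ * p * x) * x⁻¹ := by group
      _ = u * (u₁⁻¹ * x * k⁻¹) * x⁻¹ := by rw [this]
      _ = (u * u₁⁻¹) * (x * k⁻¹ * x⁻¹) := by group
  rw [hp]
  refine Subgroup.mul_mem _ (Subgroup.mem_sup_left (U.mul_mem hu (U.inv_mem hu₁)))
    (Subgroup.mem_sup_right ?_)
  exact (Subgroup.mem_smul_pointwise_iff_exists _ _ _).mpr ⟨k⁻¹, (G.vertGp v).inv_mem hk, by
    simp only [ConjAct.smul_def, ConjAct.ofConjAct_toConjAct]⟩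

variable (G)

/-- **Stabilizer transport at one level from the packages** (`U ⊴ Π_G` a level ⊇ `Ker`, `U' = β U`,
`L ⊴ Π_G`, `L' ⊴ Π_H`, `Ker ⊆ L`): if every level-`U` class `U x Π_v` corresponds to a level-`U'` class
`U' y Π_w` under `β((U ∩ Π_v^x) · L) = (U' ∩ Π_w^y) · L'` and the classes on both sides are separated modulo
`L`, `L'`, then `β(U · Π_v^x) = U' · Π_w^y`. [cite: MochizukiCombGC2007, Thm 1.6(iii) p.13] -/
theorem exists_unrTransport_vertexStabilizer_of_packages {U : Subgroup P} {U' : Subgroup P'} [U.Normal]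
    [U'.Normal] (hUU' : G.unrTransport H β U = U') {L : Subgroup P} {L' : Subgroup P'} [L.Normal] [L'.Normal]
    (hKL : G.unrKer ≤ L)
    (hP1 : ∀ (v : G.graph.V) (x : P), ∃ (w : H.graph.V) (y : P'),
      G.unrTransport H β ((U ⊓ ConjAct.toConjAct x • G.vertGp v) ⊔ L) =
        (U' ⊓ ConjAct.toConjAct y • H.vertGp w) ⊔ L')
    (hsepG : ∀ (v₁ v₂ : G.graph.V) (x₁ x₂ : P),
      (∃ u ∈ U, (U ⊓ ConjAct.toConjAct x₁ • G.vertGp v₁) ⊔ L =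
        ConjAct.toConjAct u • ((U ⊓ ConjAct.toConjAct x₂ • G.vertGp v₂) ⊔ L)) →
      (⟨v₁, DoubleCoset.mk U (G.vertGp v₁) x₁⟩ :
          Σ v, DoubleCoset.Quotient (U : Set P) (G.vertGp v : Set P)) =
        ⟨v₂, DoubleCoset.mk U (G.vertGp v₂) x₂⟩)
    (hsepH : ∀ (w₁ w₂ : H.graph.V) (y₁ y₂ : P'),
      (∃ u' ∈ U', (U' ⊓ ConjAct.toConjAct y₁ • H.vertGp w₁) ⊔ L' =
        ConjAct.toConjAct u' • ((U' ⊓ ConjAct.toConjAct y₂ • H.vertGp w₂) ⊔ L')) →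
      (⟨w₁, DoubleCoset.mk U' (H.vertGp w₁) y₁⟩ :
          Σ w, DoubleCoset.Quotient (U' : Set P') (H.vertGp w : Set P')) =
        ⟨w₂, DoubleCoset.mk U' (H.vertGp w₂) y₂⟩)
    (v : G.graph.V) (x : P) :
    ∃ (w : H.graph.V) (y : P'),
      G.unrTransport H β (U ⊔ ConjAct.toConjAct x • G.vertGp v) = U' ⊔ ConjAct.toConjAct y • H.vertGp w := by
  obtain ⟨w, y, hX⟩ := hP1 v x
  refine ⟨w, y, le_antisymm ?_ ?_⟩
  · intro y' hy'
    obtain ⟨s, hs, hsy'⟩ := (G.mem_unrTransport_iff H β).mp hy'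
    obtain ⟨u, hu, hsu⟩ := exists_conj_eq_of_mem_vertexStabilizer (L := L) hs
    obtain ⟨u', hu'U, huu'⟩ := G.exists_mem_unrTransport_mk_eq H β u hu
    rw [hUU'] at hu'U
    have h1 := G.unrTransport_conjAct_smul H β hsy' ((U ⊓ ConjAct.toConjAct x • G.vertGp v) ⊔ L)
    rw [hsu, G.unrTransport_conjAct_smul H β huu', hX] at h1
    exact mem_vertexStabilizer_of_conj_eq hsepH hu'U h1.symm
  · intro y' hy'
    obtain ⟨u', hu', hsu'⟩ := exists_conj_eq_of_mem_vertexStabilizer (L := L') hy'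
    obtain ⟨z, hz⟩ := β.surjective (QuotientGroup.mk y' : P' ⧸ H.unrKer)
    obtain ⟨p, rfl⟩ := QuotientGroup.mk_surjective z
    have hu'T : u' ∈ G.unrTransport H β U := hUU' ▸ hu'
    obtain ⟨u, hu, huu'⟩ := (G.mem_unrTransport_iff H β).mp hu'T
    have h1 := G.unrTransport_conjAct_smul H β hz ((U ⊓ ConjAct.toConjAct x • G.vertGp v) ⊔ L)
    rw [hX, hsu', ← hX, ← G.unrTransport_conjAct_smul H β huu',
      G.unrTransport_inj H β ?_ ?_] at h1
    · exact (G.mem_unrTransport_iff H β).mpr ⟨p, mem_vertexStabilizer_of_conj_eq hsepG hu h1, hz⟩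
    · rw [← Subgroup.Normal.conjAct G.unrKer_normal (ConjAct.toConjAct p)]
      exact Subgroup.pointwise_smul_le_pointwise_smul_iff.mpr (hKL.trans le_sup_right)
    · rw [← Subgroup.Normal.conjAct G.unrKer_normal (ConjAct.toConjAct u)]
      exact Subgroup.pointwise_smul_le_pointwise_smul_iff.mpr (hKL.trans le_sup_right)

end Stabilizers

/-! ### 2. Group-theoretic verticiality from stabilizer transport at all levels -/

section Clauses

variable {P : Type u} [Group P] [TopologicalSpace P] [IsTopologicalGroup P] [CompactSpace P]
  [TotallyDisconnectedSpace P]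
variable {P' : Type u} [Group P'] [TopologicalSpace P'] [IsTopologicalGroup P'] [CompactSpace P']
  [TotallyDisconnectedSpace P']
variable (G : PSCDatum P) (H : PSCDatum P') (β : (P ⧸ G.unrKer) ≃ₜ* (P' ⧸ H.unrKer))

/-- **Clause one of Def. 1.4 (iv) from stabilizer transport at all levels** (abc-iut-L5-t6's
`isUnrVerticial_iff_levelwise` on both sides). [cite: Mochizuki2012, IUTchI Rmk 1.2.3(iv) p.42] -/
theorem isUnrVerticial_unrTransport_of_levels
    (hlev : ∀ U : Subgroup P, U.Normal → IsOpen (U : Set P) → G.unrKer ≤ U →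
      ∀ (v : G.graph.V) (x : P), ∃ (w : H.graph.V) (y : P'),
        G.unrTransport H β (U ⊔ ConjAct.toConjAct x • G.vertGp v) =
          G.unrTransport H β U ⊔ ConjAct.toConjAct y • H.vertGp w)
    {B : Subgroup P} (hB : G.IsUnrVerticial B) : H.IsUnrVerticial (G.unrTransport H β B) := by
  obtain ⟨hBc, hKB, hlevB⟩ := (G.isUnrVerticial_iff_levelwise B).mp hB
  refine (H.isUnrVerticial_iff_levelwise _).mpr
    ⟨G.isClosed_unrTransport H β hBc, G.unrKer_le_unrTransport H β B, fun U' hU'n hU'o hKU' => ?_⟩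
  obtain ⟨hUn, hUo, hKU⟩ := H.level_unrTransport G β.symm hU'n hU'o
  have hUU' : G.unrTransport H β (H.unrTransport G β.symm U') = U' :=
    G.unrTransport_unrTransport_symm H β hKU'
  obtain ⟨v, γ, hvγ⟩ := hlevB _ hUn hUo hKU
  obtain ⟨w, y, hwy⟩ := hlev _ hUn hUo hKU v (ConjAct.ofConjAct γ)
  rw [ConjAct.toConjAct_ofConjAct, hUU'] at hwy
  refine ⟨w, ConjAct.toConjAct y, ?_⟩
  rw [← hUU', ← G.unrTransport_sup H β, hvγ, hUU', hwy]

omit [CompactSpace P] [TotallyDisconnectedSpace P] [CompactSpace P'] [TotallyDisconnectedSpace P'] in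
/-- **Def. 1.4 (iv) from its two clauses**, the second obtained from the first for `β⁻¹`.
[cite: MochizukiCombGC2007, Def 1.4(iv) p.11] -/
theorem isUnrGroupTheoreticallyVerticial_of_clauses
    (h₁ : ∀ B, G.IsUnrVerticial B → H.IsUnrVerticial (G.unrTransport H β B))
    (h₂ : ∀ B', H.IsUnrVerticial B' → G.IsUnrVerticial (H.unrTransport G β.symm B')) :
    G.IsUnrGroupTheoreticallyVerticial H β :=
  ⟨h₁, fun B' hB' => ⟨_, h₂ B' hB',
    G.unrTransport_unrTransport_symm H β (H.levelwise_of_isUnrVerticial hB').1⟩⟩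

end Clauses

/-! ### 3. Clause one for a verticially filtration-preserving `β`, via the pro-l shadows -/

section ProL

variable {P : Type u} [Group P] [TopologicalSpace P] [IsTopologicalGroup P] [CompactSpace P]
  [TotallyDisconnectedSpace P]
variable {P' : Type u} [Group P'] [TopologicalSpace P'] [IsTopologicalGroup P'] [CompactSpace P']
  [TotallyDisconnectedSpace P']
variable (G : PSCDatum P) (H : PSCDatum P') (β : (P ⧸ G.unrKer) ≃ₜ* (P' ⧸ H.unrKer)) {l : ℕ}

/-- **Clause one of Def. 1.4 (iv) for a verticially filtration-preserving `β`, GENERAL `Σ`** (sturdy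
`G`, `H` on profinite groups, `l ∈ Σ_G ∩ Σ_H`), granting BY NAME at every `Π^unr_G`-covering `G_U` and all
presentations `g`, `g'`: Thm. 1.6 (iii) for the pro-`l` shadow pair and every `ρ`, and Prop. 1.2 (i)
(unramified verticial case) for both shadows. [cite: MochizukiCombGC2007, Thm 1.6(iii) p.13] -/
theorem isUnrVerticial_unrTransport_of_proL (hGs : G.IsSturdy) (hHs : H.IsSturdy)
    (hl : l ∈ G.Sigma) (hl' : l ∈ H.Sigma) (bd : G.BranchData) (bd' : H.BranchData)
    (hiii : ∀ (U : Subgroup P) (_ : U.Normal) (_ : U.FiniteIndex) (_ : CompactSpace U)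
      (hU : IsOpen (U : Set P)) (U' : Subgroup P') (_ : U'.Normal) (_ : U'.FiniteIndex) (_ : CompactSpace U')
      (hU' : IsOpen (U' : Set P'))
      ⦃Q : Type u⦄ [Group Q] [TopologicalSpace Q] [IsTopologicalGroup Q] [CompactSpace Q]
      [TotallyDisconnectedSpace Q] [T2Space Q] (g : U →* Q) (hg : IsMaxProSigmaQuotient {l} g)
      ⦃Q' : Type u⦄ [Group Q'] [TopologicalSpace Q'] [IsTopologicalGroup Q'] [CompactSpace Q']
      [TotallyDisconnectedSpace Q'] [T2Space Q'] (g' : U' →* Q') (hg' : IsMaxProSigmaQuotient {l} g')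
      (ρ : (Q ⧸ ((G.restrictBD U hU bd).mapAlong g hg.continuous {l} (Set.singleton_subset_iff.mpr hl)
          (Set.singleton_nonempty l) hg.proSigma).unrKer) ≃ₜ*
        (Q' ⧸ ((H.restrictBD U' hU' bd').mapAlong g' hg'.continuous {l} (Set.singleton_subset_iff.mpr hl')
          (Set.singleton_nonempty l) hg'.proSigma).unrKer)),
      ((G.restrictBD U hU bd).mapAlong g hg.continuous {l} (Set.singleton_subset_iff.mpr hl)
        (Set.singleton_nonempty l) hg.proSigma).UnrVerticiallyFiltrationPreservingIffVerticial
        ((H.restrictBD U' hU' bd').mapAlong g' hg'.continuous {l} (Set.singleton_subset_iff.mpr hl')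
          (Set.singleton_nonempty l) hg'.proSigma) ρ)
    (h12G : ∀ (U : Subgroup P) (_ : U.Normal) (_ : U.FiniteIndex) (_ : CompactSpace U)
      (hU : IsOpen (U : Set P)) ⦃Q : Type u⦄ [Group Q] [TopologicalSpace Q] [IsTopologicalGroup Q]
      [CompactSpace Q] [TotallyDisconnectedSpace Q] [T2Space Q] (g : U →* Q)
      (hg : IsMaxProSigmaQuotient {l} g),
      ((G.restrictBD U hU bd).mapAlong g hg.continuous {l} (Set.singleton_subset_iff.mpr hl)
        (Set.singleton_nonempty l) hg.proSigma).UnrVerticialOpenInterDeterminesVertex)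
    (h12H : ∀ (U' : Subgroup P') (_ : U'.Normal) (_ : U'.FiniteIndex) (_ : CompactSpace U')
      (hU' : IsOpen (U' : Set P')) ⦃Q' : Type u⦄ [Group Q'] [TopologicalSpace Q'] [IsTopologicalGroup Q']
      [CompactSpace Q'] [TotallyDisconnectedSpace Q'] [T2Space Q'] (g' : U' →* Q')
      (hg' : IsMaxProSigmaQuotient {l} g'),
      ((H.restrictBD U' hU' bd').mapAlong g' hg'.continuous {l} (Set.singleton_subset_iff.mpr hl')
        (Set.singleton_nonempty l) hg'.proSigma).UnrVerticialOpenInterDeterminesVertex)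
    (hβ : G.IsUnrVerticiallyFiltrationPreserving H β)
    {B : Subgroup P} (hB : G.IsUnrVerticial B) : H.IsUnrVerticial (G.unrTransport H β B) := by
  refine G.isUnrVerticial_unrTransport_of_levels H β (fun U hUn hUo hKU v x => ?_) hB
  -- the two levels as profinite groups
  haveI := hUn; haveI : Finite (P ⧸ U) := Subgroup.quotient_finite_of_isOpen U hUo
  haveI : U.FiniteIndex := Subgroup.finiteIndex_of_finite_quotient
  haveI : CompactSpace U := isCompact_iff_compactSpace.mp (Subgroup.isClosed_of_isOpen U hUo).isCompact
  obtain ⟨hU'n, hU'o, hKU'⟩ := G.level_unrTransport H β hUn hUo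
  set U' := G.unrTransport H β U with hU'
  haveI := hU'n; haveI : Finite (P' ⧸ U') := Subgroup.quotient_finite_of_isOpen U' hU'o
  haveI : U'.FiniteIndex := Subgroup.finiteIndex_of_finite_quotient
  haveI : CompactSpace U' :=
    isCompact_iff_compactSpace.mp (Subgroup.isClosed_of_isOpen U' hU'o).isCompact
  -- presentations of the maximal pro-`l` quotients
  obtain ⟨K₀, hK₀n, hK₀c, hg⟩ := exists_isMaxProSigmaQuotient ({l} : Set ℕ) (P := U)
  obtain ⟨K₀', hK₀'n, hK₀'c, hg'⟩ := exists_isMaxProSigmaQuotient ({l} : Set ℕ) (P := U')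
  haveI := hK₀n; haveI := hK₀'n
  haveI : IsClosed ((K₀ : Subgroup U) : Set U) := hK₀c; haveI : IsClosed ((K₀' : Subgroup U') : Set U') := hK₀'c
  haveI : TotallyDisconnectedSpace (U ⧸ K₀) :=
    AbsoluteAnabelian.QuotientGroup.totallyDisconnectedSpace_of_isClosed K₀ hK₀c
  haveI : TotallyDisconnectedSpace (U' ⧸ K₀') :=
    AbsoluteAnabelian.QuotientGroup.totallyDisconnectedSpace_of_isClosed K₀' hK₀'c
  have hSl : ({l} : Set ℕ) ⊆ (G.restrictBD U hUo bd).Sigma := Set.singleton_subset_iff.mpr hl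
  have hSl' : ({l} : Set ℕ) ⊆ (H.restrictBD U' hU'o bd').Sigma := Set.singleton_subset_iff.mpr hl'
  have hE := G.map_subtype_unrKer_restrictBD hUo hKU bd
  have hE' := H.map_subtype_unrKer_restrictBD hU'o hKU' bd'
  obtain ⟨ρ, hρ⟩ := G.exists_unrShadowEquiv H β hUo hKU _ hE hU'o _ hE' hU'.symm hSl hSl' hg hg'
  have hρfp := IsUnrVerticiallyFiltrationPreserving.unrShadow G H β hUo hKU _ hE hU'o _ hE' hU'.symm hSl hSl'
    hg hg' hβ (fun X => G.map_subtype_vertFil_restrictBD U hUo bd X)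
    (fun X' => H.map_subtype_vertFil_restrictBD U' hU'o bd' X') ρ hρ
  have hDs : ((G.restrictBD U hUo bd).mapAlong (QuotientGroup.mk' K₀) hg.continuous {l} hSl
      (Set.singleton_nonempty l) hg.proSigma).IsSturdy :=
    ((G.restrictBD U hUo bd).isSturdy_mapAlong_iff (QuotientGroup.mk' K₀) hg.continuous {l} hSl
      (Set.singleton_nonempty l) hg.proSigma).mpr (IsSturdy.restrictBD (G := G) (U := U) (hU := hUo) (bd := bd) hGs)
  have hD's : ((H.restrictBD U' hU'o bd').mapAlong (QuotientGroup.mk' K₀') hg'.continuous {l} hSl'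
      (Set.singleton_nonempty l) hg'.proSigma).IsSturdy :=
    ((H.restrictBD U' hU'o bd').isSturdy_mapAlong_iff (QuotientGroup.mk' K₀') hg'.continuous {l} hSl'
      (Set.singleton_nonempty l) hg'.proSigma).mpr
      (IsSturdy.restrictBD (G := H) (U := U') (hU := hU'o) (bd := bd') hHs)
  haveI := G.map_subtype_unrShadowKer_normal U hUo bd hKU hSl hg
  haveI := H.map_subtype_unrShadowKer_normal U' hU'o bd' hKU' hSl' hg'
  have hρv := (hiii U hUn inferInstance inferInstance hUo U' hU'n inferInstance inferInstance hU'o _ hg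
    _ hg' ρ hDs hD's).mp hρfp
  obtain ⟨w, y, h⟩ := G.exists_unrTransport_vertexStabilizer_of_packages H β hU'.symm
    (L := (((QuotientGroup.mk' ((G.restrictBD U hUo bd).mapAlong (QuotientGroup.mk' K₀) hg.continuous {l}
      hSl (Set.singleton_nonempty l) hg.proSigma).unrKer).comp (QuotientGroup.mk' K₀)).ker).map U.subtype)
    (L' := (((QuotientGroup.mk' ((H.restrictBD U' hU'o bd').mapAlong (QuotientGroup.mk' K₀') hg'.continuous
      {l} hSl' (Set.singleton_nonempty l) hg'.proSigma).unrKer).comp (QuotientGroup.mk' K₀')).ker).map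
        U'.subtype)
    (hKL := G.unrKer_le_map_subtype_ker U _ hE hSl hg)
    (fun v x => G.unrShadow_vertex_package H β U hUo bd hKU U' hU'o bd' hU'.symm hSl hSl' hg hg' ρ hρ
      hρv v x)
    (fun v₁ v₂ x₁ x₂ hc => G.unrShadow_sep U hUo bd hKU hSl hg hDs
      (h12G U hUn inferInstance inferInstance hUo _ hg) v₁ v₂ x₁ x₂ hc)
    (fun w₁ w₂ y₁ y₂ hc => H.unrShadow_sep U' hU'o bd' hKU' hSl' hg' hD's
      (h12H U' hU'n inferInstance inferInstance hU'o _ hg') w₁ w₂ y₁ y₂ hc) v x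
  exact ⟨w, y, h⟩

end ProL

/-! ### 4. [CombGC] Theorem 1.6 (iii) over the origin, for data with a common prime -/

section Origin

variable (Ω : PSCOrigin.{u})

/-- **[CombGC] Theorem 1.6 (iii) as typed (`UnrVerticiallyFiltrationPreservingIffVerticial`), for ALL
data of `Ω`-type on profinite groups with a COMMON PRIME `l ∈ Σ_G ∩ Σ_H` and every `β : Π^unr_G ⥲ Π^unr_H`**
("we may assume `Σ = {l}`", p. 13) — every input an origin statement BY NAME: those of the `Σ = {l}`
theorem (abc-iut-w5-d174's `unrVerticialIff_holds_of_inputs'`: `RankStatementsHold`,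
`VertCountLeNodeCountSuccHolds`, the corrected [IUTchI] Rmk. 1.2.3 (iv) `UnrVerticialCharacterizationHolds'`,
`UnrVertAbOfRankHolds`, `RestrictBDOfPSCTypeHolds`), applied to the pro-`l` SHADOWS of the
`Π^unr`-coverings (`Ω`-data by `MapAlongProLOfPSCTypeHolds`, abc-iut-L3-t4, with `Σ = {l}`), and Prop. 1.2 (i)
(`OpenInterDeterminesComponentHolds`); profiniteness displayed as `hprof`; (⇐) is [IUTchI] Rmk. 1.2.3 (vii).
[cite: MochizukiCombGC2007, Thm 1.6(iii) p.13] -/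
theorem unrVerticialIff_holds_of_common_prime'
    (hprof : ∀ ⦃Q : Type u⦄ [Group Q] [TopologicalSpace Q] [IsTopologicalGroup Q] (K : PSCDatum Q),
      Ω.IsOfPSCType K → CompactSpace Q ∧ TotallyDisconnectedSpace Q)
    (hrank : RankStatementsHold Ω) (hconn : VertCountLeNodeCountSuccHolds Ω)
    (hunr : UnrVerticialCharacterizationHolds' Ω) (hrankv : UnrVertAbOfRankHolds Ω)
    (hres : RestrictBDOfPSCTypeHolds Ω) (hmap : MapAlongProLOfPSCTypeHolds Ω)
    (h12 : OpenInterDeterminesComponentHolds Ω)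
    ⦃Q : Type u⦄ [Group Q] [TopologicalSpace Q] [IsTopologicalGroup Q]
    ⦃Q' : Type u⦄ [Group Q'] [TopologicalSpace Q'] [IsTopologicalGroup Q']
    {G : PSCDatum Q} {H : PSCDatum Q'} (hGΩ : Ω.IsOfPSCType G) (hHΩ : Ω.IsOfPSCType H)
    {l : ℕ} (hl : l ∈ G.Sigma) (hl' : l ∈ H.Sigma) (β : (Q ⧸ G.unrKer) ≃ₜ* (Q' ⧸ H.unrKer)) :
    G.UnrVerticiallyFiltrationPreservingIffVerticial H β := by
  obtain ⟨bd, hbd⟩ := hres G hGΩ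
  obtain ⟨bd', hbd'⟩ := hres H hHΩ
  intro hGs hHs
  refine ⟨fun hβ => ?_, fun h =>
    Literature.IUT.HodgeTheaters.Rmk123.isUnrVerticiallyFiltrationPreserving_of_isUnrGroupTheoreticallyVerticial
      G H β h⟩
  -- Thm 1.6 (iii) at `Σ = {l}` and Prop 1.2 (i) for the shadow pairs, from the origin statements
  have key : ∀ {R : Type u} [Group R] [TopologicalSpace R] [IsTopologicalGroup R]
      {R' : Type u} [Group R'] [TopologicalSpace R'] [IsTopologicalGroup R']
      (A : PSCDatum R) (A' : PSCDatum R') (γ : (R ⧸ A.unrKer) ≃ₜ* (R' ⧸ A'.unrKer)),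
      A.IsSturdy → A'.IsSturdy → l ∈ A.Sigma → l ∈ A'.Sigma → Ω.IsOfPSCType A → Ω.IsOfPSCType A' →
      (b : A.BranchData) → (b' : A'.BranchData) →
      (∀ (U : Subgroup R) [U.FiniteIndex] (hU : IsOpen (U : Set R)), Ω.IsOfPSCType (A.restrictBD U hU b)) →
      (∀ (U' : Subgroup R') [U'.FiniteIndex] (hU' : IsOpen (U' : Set R')),
        Ω.IsOfPSCType (A'.restrictBD U' hU' b')) →
      A.IsUnrVerticiallyFiltrationPreserving A' γ →
      ∀ B, A.IsUnrVerticial B → A'.IsUnrVerticial (A.unrTransport A' γ B) := by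
    intro R _ _ _ R' _ _ _ A A' γ hAs hA's hlA hlA' hAΩ hA'Ω b b' hb hb' hγ B hB
    obtain ⟨hcR, htR⟩ := hprof A hAΩ
    obtain ⟨hcR', htR'⟩ := hprof A' hA'Ω
    haveI := hcR; haveI := htR; haveI := hcR'; haveI := htR'
    refine A.isUnrVerticial_unrTransport_of_proL A' γ hAs hA's hlA hlA' b b' ?_ ?_ ?_ hγ hB
    · intro U _ _ _ hU U' _ _ _ hU' S _ _ _ _ _ _ g hg S' _ _ _ _ _ _ g' hg' ρ
      have hD := hmap (A.restrictBD U hU b) {l} (Set.singleton_subset_iff.mpr hlA)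
        (Set.singleton_nonempty l) g hg (hb U hU)
      have hD' := hmap (A'.restrictBD U' hU' b') {l} (Set.singleton_subset_iff.mpr hlA')
        (Set.singleton_nonempty l) g' hg' (hb' U' hU')
      exact unrVerticialIff_holds_of_inputs' Ω hprof hrank hconn hunr hrankv hres hD hD' rfl rfl ρ
    · intro U _ _ _ hU S _ _ _ _ _ _ g hg
      have hD := hmap (A.restrictBD U hU b) {l} (Set.singleton_subset_iff.mpr hlA)
        (Set.singleton_nonempty l) g hg (hb U hU)
      exact (h12 _ hD).2.2
    · intro U' _ _ _ hU' S' _ _ _ _ _ _ g' hg'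
      have hD' := hmap (A'.restrictBD U' hU' b') {l} (Set.singleton_subset_iff.mpr hlA')
        (Set.singleton_nonempty l) g' hg' (hb' U' hU')
      exact (h12 _ hD').2.2
  exact G.isUnrGroupTheoreticallyVerticial_of_clauses H β
    (key G H β hGs hHs hl hl' hGΩ hHΩ bd bd' hbd hbd' hβ)
    (key H G β.symm hHs hGs hl' hl hHΩ hGΩ bd' bd hbd' hbd hβ.symm)

end Origin

end PSCDatum

end Literature.AnabelianGeometry.SemiGraphs
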